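import Summits.QuantumFields.YangMills.Theorems.UnitScaleTiltProp7PinnedRegaugeChartJunction
import HarnessLib

/-!
# Prop 7, route-R E′, (E1-c) F4k — `SU(N)` TRANSPORTS DISCHARGE THE FOUR TRANSPORT HYPOTHESES OF F4h–F4j: `‖R(U)M‖ = ‖M‖`, `‖R(U)⁻¹M‖ = ‖M‖`, `(R(U)M)* = R(U)M*`, `R(U)⁻¹(M*) = (R(U)⁻¹M)*`

Route `UnitScaleTilt`, crux K1 child «MinimiserStabilityRegPr» (`stmt-QuantumFields-19200`), cell ym3-torus, width seat px15 (gen 2); pen «px15 g2: (E1-c) GO-LOCATE» (★p1 g15,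
2026-08-28T20:45:05Z), LOCATE `LOCATE-E1C-DIVLIPSCHITZ-px15g2.md` §6 (torus instantiation step).  THEOREMS ONLY (0 `def`, 0 `sorry`); `--supports stmt-QuantumFields-19200`,
count-neutral.  YM₃ on T³ is a ladder rung (R3), not the Clay problem; nothing here claims the stub, the crux, d = 4 or the mass gap.

WHAT.  The chart-remainder rows ✓p675364 `norm_divB_chartRemainder_sub_le`, ✓p675510 `norm_chartRemainder_bond_sub_le`, ⧗p675771 (`…_psi`) take the transports abstractly through
`hR`, `hRn` (isometry both ways) and `hstarR`, `hstarRinv` (*-compatibility).  For `SU(N)`-valued transports (`(U μ x : M_N) = (W μ x : SU(N))`, the letters of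
✓ `Prop7PinnedRegaugeChartDivergence(Torus)`) all four hold: `R_eq_mul_star'` (`R(U)M = W M W*`), ✓ `Prop7PinnedRegaugeChartJunction.norm_R_eq`, ✓ `norm_R_inv_eq`, and here `star_R_eq`, `R_inv_star_eq`;
and on the torus (`U := unitsField (toUField W)`, `W : GaugeField P i SU(N)`): `norm_R_torus`, `norm_R_inv_torus'`, `star_R_torus`, `R_inv_star_torus`.
HONEST SCOPE.  Bookkeeping ([folklore]).

References: T. Bałaban, CMP 99 (1985) 389–434 [Balaban1985BackgroundPropagators] ((3.5) p.391: `U(x, x−e_μ) = U(x−e_μ, x)⁻¹`, gauge covariance p.393).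
-/

set_option autoImplicit false

noncomputable section

open scoped BigOperators Matrix.Norms.L2Operator Matrix
open NormedSpace

namespace Summit.QuantumFields.YangMills.Theorems.Prop7SUTransportRows

open Literature.MathematicalPhysics.QuantumFieldTheory.Balaban1983to89
open B1RG242Torus
open B9Eq39Adjoint (R R_def)
open B10Eq27TorusAxialLog (unitsField toUField)
open Summit.QuantumFields.YangMills.Theorems.Prop7PinnedRegaugeChartDivergence (coe_inv_eq_star R_inv_eq_star_mul)
open Summit.QuantumFields.YangMills.Theorems.Prop7PinnedRegaugeChartDivergenceTorus (norm_R_inv_eq coe_unitsField_toUField)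
open Summit.QuantumFields.YangMills.Theorems.Prop7PinnedRegaugeChartJunction (norm_R_eq)

section Abstract

variable {n : Type*} [Fintype n] [DecidableEq n] [Nonempty n]
variable {S : Type*} {ι : Type*} (U : ι → S → (Matrix n n ℂ)ˣ) (W : ι → S → Matrix.specialUnitaryGroup n ℂ)

omit [Nonempty n] in
/-- `R(U μ y)M = W M W*` for `SU(N)`-valued transports. [folklore] -/
theorem R_eq_mul_star' (hUW : ∀ μ x, (U μ x : Matrix n n ℂ) = (W μ x : Matrix n n ℂ)) (μ : ι) (y : S) (M : Matrix n n ℂ) :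
    R (U μ y) M = (W μ y : Matrix n n ℂ) * M * star (W μ y : Matrix n n ℂ) := by
  rw [R_def, coe_inv_eq_star U W hUW, hUW]

omit [Nonempty n] in
/-- `(R(U μ y)M)* = R(U μ y)(M*)`. [folklore] -/
theorem star_R_eq (hUW : ∀ μ x, (U μ x : Matrix n n ℂ) = (W μ x : Matrix n n ℂ)) (μ : ι) (y : S) (M : Matrix n n ℂ) :
    star (R (U μ y) M) = R (U μ y) (star M) := by
  rw [R_eq_mul_star' U W hUW, R_eq_mul_star' U W hUW, star_mul, star_mul, star_star, mul_assoc]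

omit [Nonempty n] in
/-- `R(U μ y)⁻¹(M*) = (R(U μ y)⁻¹M)*`. [folklore] -/
theorem R_inv_star_eq (hUW : ∀ μ x, (U μ x : Matrix n n ℂ) = (W μ x : Matrix n n ℂ)) (μ : ι) (y : S) (M : Matrix n n ℂ) :
    R (U μ y)⁻¹ (star M) = star (R (U μ y)⁻¹ M) := by
  rw [R_inv_eq_star_mul U W hUW, R_inv_eq_star_mul U W hUW, star_mul, star_mul, star_star, mul_assoc]

end Abstract

/-! ## On the torus -/

section Torus

variable {P : Params} {N : ℕ} [NeZero N] {i : ℕ}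

/-- The four transport rows for `U := unitsField (toUField W)`, `W : GaugeField P i SU(N)`. [folklore] -/
theorem transportRows_torus (W : GaugeField P i (Matrix.specialUnitaryGroup (Fin N) ℂ)) :
    (∀ (κ : Fin P.d) (y : Site P i) (M : Matrix (Fin N) (Fin N) ℂ), ‖R ((fun κ z => unitsField (toUField W) ⟨z, κ⟩) κ y) M‖ = ‖M‖)
    ∧ (∀ (κ : Fin P.d) (y : Site P i) (M : Matrix (Fin N) (Fin N) ℂ), ‖R ((fun κ z => unitsField (toUField W) ⟨z, κ⟩) κ y)⁻¹ M‖ = ‖M‖)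
    ∧ (∀ (κ : Fin P.d) (y : Site P i) (M : Matrix (Fin N) (Fin N) ℂ),
        star (R ((fun κ z => unitsField (toUField W) ⟨z, κ⟩) κ y) M) = R ((fun κ z => unitsField (toUField W) ⟨z, κ⟩) κ y) (star M))
    ∧ (∀ (κ : Fin P.d) (y : Site P i) (M : Matrix (Fin N) (Fin N) ℂ),
        R ((fun κ z => unitsField (toUField W) ⟨z, κ⟩) κ y)⁻¹ (star M) = star (R ((fun κ z => unitsField (toUField W) ⟨z, κ⟩) κ y)⁻¹ M)) := by
  have hUW := coe_unitsField_toUField W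
  exact ⟨norm_R_eq _ (fun κ z => W ⟨z, κ⟩) hUW, norm_R_inv_eq _ (fun κ z => W ⟨z, κ⟩) hUW, star_R_eq _ (fun κ z => W ⟨z, κ⟩) hUW,
    R_inv_star_eq _ (fun κ z => W ⟨z, κ⟩) hUW⟩

end Torus

end Summit.QuantumFields.YangMills.Theorems.Prop7SUTransportRows

end
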